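import Summits.NavierStokesRegularity.NavierStokesRegularity.Theorems.TypeILiouvilleTypeIliouvilleLStubOseenConstBoost
import Literature.Analysis.FluidPDE.KNSSRegularityGalileanProofs
import Literature.Analysis.FluidPDE.OseenHeatKernelBridge
import HarnessLib

/-!
# Route `GaldiLiouvilleGate`, crux `RecordZoomAncient` (stmt-NavierStokesRegularity-0894),
  line `registered` (birth skeleton, reshape r8) — stub `stub_galileanOseen`
  (Galilean covariance of bounded Oseen-mild ancient fields under a constant boost)

**Statement.** Let `W : (−∞, 0) × ℝ³ → ℝ³` be continuous on `(−∞, 0) × ℝ³`, bounded by `K`,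
with weakly divergence-free slices, and satisfying the Oseen integral identity
`W(t) = e^{(t−s)Δ}W(s) − B¹_s(W, W)(t)` pointwise for all `s < t < 0`. Then for every constant
vector `c ∈ ℝ³` the co-moving field `W̃(t, y) = W(t, y + t c) − c` is again continuous on
`(−∞, 0) × ℝ³`, bounded by `K + ‖c‖`, has weakly divergence-free slices, and satisfies the same
Oseen identity `W̃(t) = e^{(t−s)Δ}W̃(s) − B¹_s(W̃, W̃)(t)` for all `s < t < 0`.

**Proof.** This is, verbatim, the tree's constant Galilean boost of bounded Oseen-mild ancient
fields `stub_oseen_const_boost` (file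
`Theorems/TypeILiouvilleTypeIliouvilleLStubOseenConstBoost.lean`, landed for the crux
`TypeIliouvilleL`), whose content is the reduction described in the skeleton: on each window the
re-clocked pair `U(τ) = W(τ + a) − c`, `b ≡ c` is drift-mild (`IsKNSSDriftMild`; the bridge
`driftDuhamel_zero_eq_oseenDuhamel`, `heatExtension` of a constant), the tree's
`IsKNSSDriftMild.galileanCovariance_R3` makes `galileanShift U b = W̃(· + a)`
(`driftPath (fun _ => c) τ = τ • c`) drift-mild with zero drift, and
`IsKNSSDriftMild.eq_heatExtension_sub_oseenDuhamel` returns the Oseen identity. Here we only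
identify the abstract boosted field `Wc` with `fun t y => W t (y + t • c) - c` (function
extensionality on the defining hypothesis) and record the explicit bound `K + ‖c‖`
(`‖W − c‖ ≤ ‖W‖ + ‖c‖`), which `stub_oseen_const_boost` only states existentially.
-/

noncomputable section

open Set MeasureTheory Filter Topology Function Literature.Analysis Literature.Analysis.FluidPDE
open scoped ENNReal NNReal

namespace Summit.NavierStokesRegularity.NavierStokesRegularity.Theorems.RecordZoomAncient.Birth

-- the problem-side namespace `Summit.NavierStokesRegularity.NavierStokesRegularity.…` (summit =
-- problem for this single-problem summit) duplicates `NavierStokesRegularity` by design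
set_option linter.dupNamespace false

/-- **Stub R5 `stub_galileanOseen` of the line `registered` (birth skeleton, reshape r8):
Galilean covariance of bounded Oseen-mild ancient fields under a constant boost.** If `W` is
continuous on `(−∞, 0) × ℝ³`, bounded by `K`, with weakly divergence-free slices and the Oseen
integral identity `W(t) = e^{(t−s)Δ}W(s) − B¹_s(W, W)(t)` pointwise for all `s < t < 0`, then
for every constant vector `c` the co-moving field `W̃(t, y) = W(t, y + t c) − c` has the same
four properties (bound `K + ‖c‖`). Proof: after identifying `Wc` with
`fun t y => W t (y + t • c) - c`, continuity, weak divergence-freeness and the Oseen identity are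
the tree's `stub_oseen_const_boost` (Galilean covariance of KNSS's drift-mild class,
`IsKNSSDriftMild.galileanCovariance_R3`, read through
`IsKNSSDriftMild.eq_heatExtension_sub_oseenDuhamel`); the bound is `‖W − c‖ ≤ ‖W‖ + ‖c‖`. -/
theorem stub_galileanOseen :
    ∀ (W Wc : ℝ → EuclideanSpace ℝ (Fin 3) → EuclideanSpace ℝ (Fin 3)) (K : ℝ) (c : EuclideanSpace ℝ (Fin 3)),
      ContinuousOn (Function.uncurry W) (Set.Iio 0 ×ˢ Set.univ) →
      (∀ t < 0, ∀ y, ‖W t y‖ ≤ K) →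
      (∀ t < 0, IsWeaklyDivFree (W t)) →
      (∀ s t : ℝ, s < t → t < 0 → ∀ y,
        W t y = Literature.Analysis.UnboundedOperators.heatExtension (W s) (t - s) y - oseenDuhamel 1 s W W t y) →
      (∀ t y, Wc t y = W t (y + t • c) - c) →
      ContinuousOn (Function.uncurry Wc) (Set.Iio 0 ×ˢ Set.univ) ∧
      (∀ t < 0, ∀ y, ‖Wc t y‖ ≤ K + ‖c‖) ∧
      (∀ t < 0, IsWeaklyDivFree (Wc t)) ∧
      (∀ s t : ℝ, s < t → t < 0 → ∀ y,
        Wc t y = Literature.Analysis.UnboundedOperators.heatExtension (Wc s) (t - s) y -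
          oseenDuhamel 1 s Wc Wc t y) := by
  intro W Wc K c hcont hK hdiv hmild hWc
  -- the boosted field is, extensionally, `fun t y => W t (y + t • c) - c`
  have hWf : Wc = fun t y => W t (y + t • c) - c := funext fun t => funext (hWc t)
  subst hWf
  obtain ⟨h1, -, h3, h4⟩ := stub_oseen_const_boost W c hcont ⟨K, hK⟩ hdiv hmild
  refine ⟨h1, fun t ht y => ?_, h3, h4⟩
  -- the explicit bound `K + ‖c‖`
  show ‖W t (y + t • c) - c‖ ≤ K + ‖c‖
  exact (norm_sub_le _ _).trans (add_le_add (hK t ht _) le_rfl)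

end Summit.NavierStokesRegularity.NavierStokesRegularity.Theorems.RecordZoomAncient.Birth

end
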